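import Summits.CriticalPhenomena.CardyFormulaZ2.Theses.CardyDualCurrent

/-!
# `TemplateCanonicalLimit` is automatically uniform over the discrete arcs (crux stmt-CriticalPhenomena-11395)

Route `CardyDualCurrent`, sub-problem `CriticalPhenomena/CardyFormulaZ2`, crux `MartingaleToSLE6`
(`TemplateCanonicalLimit → SLE6InterfaceLimit`), line `registered`, lead c2.

The antecedent `TemplateCanonicalLimit` asks for the canonical spin-`1/3` limit of a local
template observable along EVERY `ZdDiscretisationFamily E` of EVERY Dobrushin domain `D`, the
limit being taken per pair `(D, E)` along `δ → 0⁺`, with unit phases `θ_δ` that may depend on the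
pair. A family is rigid in its carrier (`(E δ).Ω = D.carrier`, `(E δ).δ = δ`) and free only in its
discrete arcs and marked boundary edges (Hausdorff-convergent to the continuum arcs / marked
points) and in WHICH admissible data it uses at each mesh. This file records, kernel-checked, the
exact extent of the uniformity hidden in the quantifier "every family":

* `exists_zdDiscretisationFamily_through` — DIAGONAL FAMILIES: given one family `E₀` of `D` and
  any sequence of admissible data `Es n` on the carrier of `D` with positive meshes and arcs /
  marked edges within Hausdorff distance `1/(n+1)` of those of `D`,
  there is a family of `D` passing through the sequence (`E ((Es n).δ) = Es m` for some `m` with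
  the same mesh).
* `uniformOverArcs_of_forall_family` — hence a per-family limit statement of the shape of
  `TemplateCanonicalLimit` (for an arbitrary observable `Φ`, arbitrary limit `q`) is automatically
  UNIFORM over all admissible data on the carrier of `D` whose mesh is small and whose arcs and
  marked edges are Hausdorff-close to those of `D`: for every compact `K ⊆ D` and `ε > 0` there is
  `η > 0` such that every such datum admits ONE unit phase `θ₀` putting `θ₀ · Φ` within `ε` of `q`
  on `K`, for both edge types.
* `templateCanonicalLimit_uniformOverArcs` — the route-shaped corollary for the crux's antecedent,
  verbatim its observable `G`.

What the argument CANNOT give is uniformity across CARRIERS: a family has the fixed carrier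
`D.carrier`, so data on other carriers (in particular the slit / pinned data met along the
exploration at conditioning steps `n ≥ 1`, in `δ`-dependent random domains) belong to no family of
`D`, and a per-carrier limit statement constrains no diagonal sequence with varying carriers. This
is the precise sense in which the antecedent of `MartingaleToSLE6` is idle for the martingale
identification (see the crux directory, `BLOCKED-ON-stmt-11283.md`, `RESTATEMENT.lean`).
-/

noncomputable section

namespace Summit.CriticalPhenomena.CardyFormulaZ2.Theorems

open scoped Topology ENNReal
open Filter Set Metric MeasureTheory
open Literature.Probability.LatticeModels Literature.Probability.RandomPlanarGeometry
open Literature.Probability.Percolation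
open Summit.CriticalPhenomena.CardyFormulaZ2.Theses.CardyDualCurrent (TemplateCanonicalLimit)

namespace MartingaleToSLE6ArcUniformity

/-- **Diagonal families.** Let `E₀` be a discretisation family of the Dobrushin domain `D` and
`Es n` admissible Dobrushin data on the carrier of `D` with positive meshes, arcs
within Hausdorff distance `1/(n+1)` of the arcs of `D` and marked boundary edges within `1/(n+1)`
of the marked points. Then some discretisation family `E` of `D` passes through the whole
sequence: at the mesh of `Es n` it is one of the `Es m` of that mesh. (Take `Es` on the meshes of
the sequence and `E₀` elsewhere; only finitely many `Es m` have a given lower bound on their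
tolerance `1/(m+1)`, and finitely many positive meshes are eventually avoided by `δ → 0⁺`.)
[folklore] -/
theorem exists_zdDiscretisationFamily_through {D : DobrushinDomain} {E₀ : ℝ → DiscreteDobrushin}
    (hE₀ : ZdDiscretisationFamily D E₀) (Es : ℕ → DiscreteDobrushin)
    (hΩ : ∀ n, (Es n).Ω = D.carrier) (hpos : ∀ n, 0 < (Es n).δ)
    (hadm : ∀ n, (Es n).IsZdAdmissible)
    (hA : ∀ n, hausdorffEDist (Es n).arcA (D.arc 0) < ENNReal.ofReal (1 / ((n : ℝ) + 1)))
    (hB : ∀ n, hausdorffEDist (Es n).arcB (D.arc 1) < ENNReal.ofReal (1 / ((n : ℝ) + 1)))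
    (hab : ∀ n, hausdorffEDist (medialPoint (Es n).δ '' (Es n).zdABEdges) {D.pt 0, D.pt 1} <
      ENNReal.ofReal (1 / ((n : ℝ) + 1))) :
    ∃ E : ℝ → DiscreteDobrushin, ZdDiscretisationFamily D E ∧
      ∀ n, ∃ m, (Es m).δ = (Es n).δ ∧ E (Es n).δ = Es m := by
  classical
  -- the diagonal family: `Es` on the meshes of the sequence, `E₀` elsewhere
  let E : ℝ → DiscreteDobrushin := fun δ =>
    if h : ∃ n, (Es n).δ = δ then Es (Classical.choose h) else E₀ δ
  have hspec : ∀ δ, (∃ m, (Es m).δ = δ ∧ E δ = Es m) ∨ ((∀ n, (Es n).δ ≠ δ) ∧ E δ = E₀ δ) := by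
    intro δ
    by_cases h : ∃ n, (Es n).δ = δ
    · exact Or.inl ⟨Classical.choose h, Classical.choose_spec h, by simp only [E, dif_pos h]⟩
    · exact Or.inr ⟨fun n hn => h ⟨n, hn⟩, by simp only [E, dif_neg h]⟩
  -- the tolerances `1/(n+1)` tend to `0` in `ℝ≥0∞`
  have hu : Tendsto (fun n : ℕ => ENNReal.ofReal (1 / ((n : ℝ) + 1))) atTop (𝓝 0) := by
    have := ENNReal.tendsto_ofReal (tendsto_one_div_add_atTop_nhds_zero_nat)
    simpa using this
  -- generic transfer of a Hausdorff-type convergence to the diagonal family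
  have key : ∀ F : ℝ → DiscreteDobrushin → ℝ≥0∞,
      Tendsto (fun δ => F δ (E₀ δ)) (𝓝[>] 0) (𝓝 0) →
      (∀ n, F (Es n).δ (Es n) < ENNReal.ofReal (1 / ((n : ℝ) + 1))) →
      Tendsto (fun δ => F δ (E δ)) (𝓝[>] 0) (𝓝 0) := by
    intro F h₀ hs
    rw [ENNReal.tendsto_nhds_zero] at h₀ ⊢
    intro ε hε
    obtain ⟨M, hM⟩ := ((tendsto_order.1 hu).2 ε hε).exists_forall_of_atTop
    have hfin : ∀ᶠ δ in 𝓝[>] (0 : ℝ), ∀ n ∈ Finset.range M, δ < (Es n).δ :=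
      (Finset.range M).eventually_all.2 fun n _ =>
        (eventually_lt_nhds (hpos n)).filter_mono nhdsWithin_le_nhds
    filter_upwards [h₀ ε hε, hfin] with δ h1 h2
    rcases hspec δ with ⟨m, hm, hEq⟩ | ⟨-, hEq⟩
    · rw [hEq]
      have hmM : M ≤ m := by
        by_contra hlt'
        have := h2 m (Finset.mem_range.2 (not_le.1 hlt'))
        rw [hm] at this
        exact lt_irrefl _ this
      rw [← hm]
      exact ((hs m).trans (hM m hmM)).le
    · rw [hEq]
      exact h1
  refine ⟨E, ⟨?_, ?_, ?_, ?_, ?_, ?_⟩, ?_⟩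
  · -- Ω_eq
    intro δ
    rcases hspec δ with ⟨m, -, hEq⟩ | ⟨-, hEq⟩
    · rw [hEq]; exact hΩ m
    · rw [hEq]; exact hE₀.Ω_eq δ
  · -- δ_eq
    intro δ
    rcases hspec δ with ⟨m, hm, hEq⟩ | ⟨-, hEq⟩
    · rw [hEq]; exact hm
    · rw [hEq]; exact hE₀.δ_eq δ
  · -- tendsto_arcA
    exact key (fun _ E' => hausdorffEDist E'.arcA (D.arc 0)) hE₀.tendsto_arcA hA
  · -- tendsto_arcB
    exact key (fun _ E' => hausdorffEDist E'.arcB (D.arc 1)) hE₀.tendsto_arcB hB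
  · -- tendsto_zdABEdges
    exact key (fun δ E' => hausdorffEDist (medialPoint δ '' E'.zdABEdges) {D.pt 0, D.pt 1})
      hE₀.tendsto_zdABEdges hab
  · -- eventually_isZdAdmissible
    filter_upwards [hE₀.eventually_isZdAdmissible] with δ h
    rcases hspec δ with ⟨m, -, hEq⟩ | ⟨-, hEq⟩
    · rw [hEq]; exact hadm m
    · rw [hEq]; exact h
  · -- the family passes through the sequence
    intro n
    rcases hspec (Es n).δ with ⟨m, hm, hEq⟩ | ⟨hne, -⟩
    · exact ⟨m, hm, hEq⟩
    · exact absurd rfl (hne n)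

/-- **A per-family limit statement is uniform over the discrete arcs.** Let `Φ E' δ w i` be any
complex observable of Dobrushin data (read at mesh `δ`, bulk point `w`, edge type `i`) and `q` any
function. If for EVERY discretisation family `E` of the Dobrushin domain `D` there are unit phases
`θ_δ` with `θ_δ · Φ (E δ) δ · i → q` locally uniformly on `D` as `δ → 0⁺` (both edge types), and
`D` has at least one family `E₀`, then for every compact `K ⊆ D` and `ε > 0` there is `η > 0` such
that EVERY admissible datum `E'` on the carrier of `D` with mesh `< η` and arcs / marked edges
within Hausdorff distance `η` of those of `D` admits one unit phase `θ₀` with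
`‖θ₀ · Φ E' (E'.δ) w i − q w‖ < ε` for all `w ∈ K` and both `i`. (Contradiction: a bad sequence
with tolerances `1/(n+1)` rides on a diagonal family, `exists_zdDiscretisationFamily_through`,
along which the hypothesis forces convergence.) Uniformity across CARRIERS is not obtainable this
way: a family has the fixed carrier `D.carrier`. [folklore] -/
theorem uniformOverArcs_of_forall_family {D : DobrushinDomain}
    (Φ : DiscreteDobrushin → ℝ → ℂ → Fin 2 → ℂ) (q : ℂ → ℂ)
    {E₀ : ℝ → DiscreteDobrushin} (hE₀ : ZdDiscretisationFamily D E₀)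
    (h : ∀ E : ℝ → DiscreteDobrushin, ZdDiscretisationFamily D E → ∃ θ : ℝ → ℂ, (∀ δ, ‖θ δ‖ = 1) ∧
      ∀ i : Fin 2, TendstoLocallyUniformlyOn (fun δ w => θ δ * Φ (E δ) δ w i) q (𝓝[>] 0) D.carrier)
    {K : Set ℂ} (hK : IsCompact K) (hKD : K ⊆ D.carrier) {ε : ℝ} (hε : 0 < ε) :
    ∃ η : ℝ, 0 < η ∧ ∀ E' : DiscreteDobrushin, E'.Ω = D.carrier → 0 < E'.δ → E'.δ < η →
      E'.IsZdAdmissible →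
      hausdorffEDist E'.arcA (D.arc 0) < ENNReal.ofReal η →
      hausdorffEDist E'.arcB (D.arc 1) < ENNReal.ofReal η →
      hausdorffEDist (medialPoint E'.δ '' E'.zdABEdges) {D.pt 0, D.pt 1} < ENNReal.ofReal η →
      ∃ θ₀ : ℂ, ‖θ₀‖ = 1 ∧ ∀ i : Fin 2, ∀ w ∈ K, ‖θ₀ * Φ E' E'.δ w i - q w‖ < ε := by
  by_contra hcon
  push Not at hcon
  choose Es hΩ hpos hlt hadm hA hB hab hbad using
    fun n : ℕ => hcon (1 / ((n : ℝ) + 1)) (by positivity)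
  obtain ⟨E, hE, hthrough⟩ :=
    exists_zdDiscretisationFamily_through hE₀ Es hΩ hpos hadm hA hB hab
  obtain ⟨θ, hθ, hconv⟩ := h E hE
  -- uniform convergence on the compact `K`, both edge types at once
  have hunif : ∀ i : Fin 2, ∀ᶠ δ in 𝓝[>] (0 : ℝ), ∀ w ∈ K,
      dist (q w) (θ δ * Φ (E δ) δ w i) < ε := fun i =>
    Metric.tendstoUniformlyOn_iff.1
      ((tendstoLocallyUniformlyOn_iff_tendstoUniformlyOn_of_compact hK).1 ((hconv i).mono hKD))
      ε hε
  have hall : ∀ᶠ δ in 𝓝[>] (0 : ℝ), ∀ i : Fin 2, ∀ w ∈ K,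
      dist (q w) (θ δ * Φ (E δ) δ w i) < ε :=
    eventually_all.2 hunif
  -- the meshes of the bad sequence tend to `0⁺`
  have hδs : Tendsto (fun n => (Es n).δ) atTop (𝓝[>] (0 : ℝ)) := by
    refine tendsto_nhdsWithin_iff.2 ⟨?_, Eventually.of_forall hpos⟩
    exact squeeze_zero (fun n => (hpos n).le) (fun n => (hlt n).le)
      tendsto_one_div_add_atTop_nhds_zero_nat
  obtain ⟨n, hn⟩ := (hδs.eventually hall).exists
  obtain ⟨m, hm, hEq⟩ := hthrough n
  obtain ⟨i, w, hw, hge⟩ := hbad m (θ (Es n).δ) (hθ _)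
  have key := hn i w hw
  rw [hEq, dist_comm, dist_eq_norm] at key
  rw [hm] at hge
  exact absurd key (not_lt.2 hge)

end MartingaleToSLE6ArcUniformity

open MartingaleToSLE6ArcUniformity

/-- **`TemplateCanonicalLimit` is uniform over the discrete arcs of each Dobrushin domain.** If the
crux's antecedent `TemplateCanonicalLimit` holds, its template `(r, m, z, s, g)` and lattice
constant `C > 0` satisfy: for every Dobrushin domain `D` possessing a discretisation family, every
chordal uniformizer `φ`, every holomorphic cube root `q` of `ψ'/ψ` (`ψ = φ⁻¹`), every compact
`K ⊆ D` and `ε > 0` there is `η > 0` such that for EVERY admissible Dobrushin datum `E'` on the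
carrier of `D` with mesh `E'.δ < η` and arcs / marked edges within Hausdorff distance `η` of those
of `D`, one unit phase `θ₀` gives `‖θ₀ · C · (E'.δ)^(-1/3) · G E' ⌊w/E'.δ⌋ i − q w‖ < ε` on `K`
for both edge types `i` — the observable `G` being verbatim that of the route. The quantifier
"every family" thus already carries uniformity over arcs and marked edges; what it does not carry
is uniformity over carriers (slit / pinned data), which is what the martingale identification of
`MartingaleToSLE6` reads. [folklore] -/
theorem templateCanonicalLimit_uniformOverArcs : TemplateCanonicalLimit →
    ∃ (r m : ℕ) (z : Fin 2 → Fin m → MedialVertex) (s : Fin 2 → Fin m → ℝ)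
      (g : Fin 2 → Fin m → Set MedialVertex → ℂ) (C : ℝ), 0 < C ∧
      (∀ i k, medialGraph.edist s((0 : Site 2), Pi.single i 1) (z i k) ≤ (r : ℕ∞)) ∧
      (let G : DiscreteDobrushin → Site 2 → Fin 2 → ℂ := fun D x i => ∫ cfg, (∑ k, g i k
          {e | medialGraph.edist s((0 : Site 2), Pi.single i 1) e ≤ (r : ℕ∞) ∧
            Sym2.map (· + x) e ∈ cfg} *
          passageSum (fkInterface D cfg) D.δ (s i k) (Sym2.map (· + x) (z i k)))
          ∂(bondPercolation (zdGraph 2) half);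
      ∀ (D : DobrushinDomain) (E₀ : ℝ → DiscreteDobrushin), ZdDiscretisationFamily D E₀ →
      ∀ (φ : ConformalEquiv UpperHalfPlane.upperHalfPlaneSet D.carrier),
        D.IsChordalUniformizing φ →
      ∀ q : ℂ → ℂ, DifferentiableOn ℂ q D.carrier →
        (∀ w ∈ D.carrier, q w ^ 3 = deriv φ.symm w / φ.symm w) →
      ∀ K ⊆ D.carrier, IsCompact K → ∀ ε : ℝ, 0 < ε →
      ∃ η : ℝ, 0 < η ∧ ∀ E' : DiscreteDobrushin, E'.Ω = D.carrier → 0 < E'.δ → E'.δ < η →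
        E'.IsZdAdmissible →
        hausdorffEDist E'.arcA (D.arc 0) < ENNReal.ofReal η →
        hausdorffEDist E'.arcB (D.arc 1) < ENNReal.ofReal η →
        hausdorffEDist (medialPoint E'.δ '' E'.zdABEdges) {D.pt 0, D.pt 1} < ENNReal.ofReal η →
        ∃ θ₀ : ℂ, ‖θ₀‖ = 1 ∧ ∀ i : Fin 2, ∀ w ∈ K,
          ‖θ₀ * C * (((E'.δ) ^ (-(1 / 3 : ℝ)) : ℝ) : ℂ) *
              G E' (fun j => ⌊(if j = 0 then w.re else w.im) / E'.δ⌋) i - q w‖ < ε) := by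
  intro hT
  obtain ⟨r, m, z, s, g, C, hC, hrange, hlim⟩ := hT
  refine ⟨r, m, z, s, g, C, hC, hrange, ?_⟩
  intro G D E₀ hE₀ φ hφ q hq hq3 K hKD hK ε hε
  -- the observable in the abstract form `θ · Φ`
  let Φ : DiscreteDobrushin → ℝ → ℂ → Fin 2 → ℂ := fun E' δ w i =>
    (C : ℂ) * (((δ ^ (-(1 / 3 : ℝ)) : ℝ) : ℂ) * G E' (fun j => ⌊(if j = 0 then w.re else w.im) / δ⌋) i)
  have h : ∀ E : ℝ → DiscreteDobrushin, ZdDiscretisationFamily D E → ∃ θ : ℝ → ℂ,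
      (∀ δ, ‖θ δ‖ = 1) ∧ ∀ i : Fin 2,
        TendstoLocallyUniformlyOn (fun δ w => θ δ * Φ (E δ) δ w i) q (𝓝[>] 0) D.carrier := by
    intro E hE
    obtain ⟨θ, hθ, hconv⟩ := hlim D E hE φ hφ q hq hq3
    refine ⟨θ, hθ, fun i => ?_⟩
    have heq : (fun (δ : ℝ) (w : ℂ) => θ δ * C * ((δ ^ (-(1 / 3 : ℝ)) : ℝ) : ℂ) *
        G (E δ) (fun j => ⌊(if j = 0 then w.re else w.im) / δ⌋) i) =
        fun δ w => θ δ * Φ (E δ) δ w i := by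
      funext δ w
      simp only [Φ, mul_assoc]
    rw [← heq]
    exact hconv i
  obtain ⟨η, hη, hunif⟩ := uniformOverArcs_of_forall_family Φ q hE₀ h hK hKD hε
  refine ⟨η, hη, fun E' hΩ' hpos' hlt' hadm' hA' hB' hab' => ?_⟩
  obtain ⟨θ₀, hθ₀, hclose⟩ := hunif E' hΩ' hpos' hlt' hadm' hA' hB' hab'
  refine ⟨θ₀, hθ₀, fun i w hw => ?_⟩
  have key := hclose i w hw
  simpa only [Φ, mul_assoc] using key

end Summit.CriticalPhenomena.CardyFormulaZ2.Theorems

end
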